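import Literature.Analysis.FluidPDE.NormalisedPressure
import Literature.Analysis.FluidPDE.LerayHopf
import Literature.Analysis.FluidPDE.NSWave0
import Literature.Analysis.FluidPDE.KNSSTypeIIHolds
import Literature.Analysis.FluidPDE.LerayHopfTranslate
import Literature.Analysis.FluidPDE.ClassicalSolutionGlue
import HarnessLib

/-!
# Named fact: the one-sided pressure / head-pressure regularity criterion of Seregin–Šverák (2002)

Literature file (D-0014 named fact, cite item `wi-10943`) for the route
`NavierStokesRegularity/BernoulliDeceleration` (crux `OneSidedHeadRegularity`,
stmt-NavierStokesRegularity-3033; also `LocalOneSidedHeadRegularity`, stmt-3034).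

G. Seregin, V. Šverák, *Navier–Stokes equations with lower bounds on the pressure*,
Arch. Ration. Mech. Anal. **163** (2002), 65–86, main theorem. Printed abstract (Springer record
of doi:10.1007/s002050200199): "weak solutions of the three-dimensional incompressible
Navier–Stokes equations are smooth if the negative part of the pressure is controlled, or if the
positive part of the quantity `|v|² + 2p` is controlled." The primary text is paywalled here
(acquisition `acq-01580`, cite-only); the statement below is transcribed from the secondary
restatement **Tran–Yu 2017, Thm. 1** ("Theorem 1 (Seregin & Šverák, 2002)", Appl. Math. Lett. 67,
p. 2), which prints, for the Cauchy problem `∂ₜu + (u·∇)u + ∇p = Δu`, `∇·u = 0` on `ℝ³ × (0, ∞)`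
with `u(·,0) = u₀` divergence-free, smooth and decaying sufficiently fast at infinity:

> Let `g : ℝ³ × (0, ∞) → [0, ∞)` be such that for any `t₀ > 0` there exists `r = r(t₀) > 0` with
> `sup_{x₀ ∈ ℝ³} sup_{t₀ - r² ≤ t ≤ t₀} ∫_{B(x₀, r)} g(x, t) |x - x₀|⁻¹ dx < ∞`. If
> `|u(x,t)|²/2 + p(x,t) ≤ g(x,t)` or `p(x,t) ≥ -2 g(x,t)` for `x ∈ ℝ³` and `t ∈ (0, ∞)`, then
> `u(x, t)` is smooth and unique.

Here `p` is the pressure of the Cauchy problem normalised to zero at infinity,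
`p = RᵢRⱼ(uᵢuⱼ) = -Δ⁻¹∂ᵢ∂ⱼ(uᵢuⱼ)` (Tran–Yu 2015, p. 1: "no singularities can develop if `p`
('normalized' to zero at infinity) is bounded from below"), i.e. the tree's
`Literature.Analysis.FluidPDE.normalisedPressure (u t)`. A constant `g ≡ K ≥ 0` is admissible
(`∫_{B(x₀,r)} K |x - x₀|⁻¹ dx = 2πK r²`), which is the only case vendored here (the route needs no
more; the admissible class of `g` "needs slightly less" than boundedness).

## Rendering (as `hasSmoothExtensionPast_of_eLpNorm_three_bounded` renders ESS 2003 and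
`ess_sup_bound` renders ESS 2003 (3.6))

For the tree's classes: `ν > 0`, `T > 0`, `(u, p)` a classical solution of the unforced system on
`ℝ³ × [0, T)` (`IsClassicalNSSolutionOn (Ico 0 T) ν 0 u p`) which is Leray–Hopf on `[0, T)` from
its rapidly decaying datum `u 0` (`IsLerayHopfOn`, `HasRapidSpatialDecay`) — a smooth, suitable,
finite-energy solution of the Cauchy problem from Schwartz-class data, inside the printed class;
its Leray–Hopf pressure is the normalised one (the classical `p` differs from `p̃[u(t)]` by a
function of time only, Tao 2011, Lemma 4.1 (i) = `tao_pressure_normalisation`, and the local energy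
inequality does not see `c(t)` since `div u = 0`). Hypothesis: `|u|²/2 + p̃ ≤ K` on
`(0, T) × ℝ³`, or `p̃ ≥ -K` there. Conclusion ("`u` is smooth", i.e. regular up to the final time
`T` of the interval on which the one-sided bound holds — the criterion is backward-looking in time,
`t₀ - r² ≤ t ≤ t₀`): `u` is bounded on `ℝ³ × (δ, T)` for every `δ ∈ (0, T)`, the form in which
`ess_sup_bound` renders the parallel line (3.6) of Escauriaza–Seregin–Šverák 2003. Printed for
viscosity `1`; `ν > 0` by `(s, x) ↦ (ν⁻¹ u(s/ν, x), ν⁻² p(s/ν, x))`, under which one-sided bounds by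
constants and boundedness are invariant. On this class `normalisedPressure (u t)` is the genuine
principal value at every point, never the junk value (`hasPressurePV_of_contDiff_holds`,
`NormalisedPressurePV.lean`: `C¹ ∩ L²` fields; the slices are smooth with finite energy,
`IsLerayHopfOn.memLp`), so the one-sided hypotheses are not vacuous. Nothing is asserted; users
take `(h : seregin_sverak_2002)`.

## Proved corollaries (the consumer's shape)

* `seregin_sverak_2002.hasSmoothExtensionPast_of_continuation`: with the continuation of bounded
  classical Leray–Hopf solutions (`hasSmoothExtensionPast_of_bounded`, RRS 2016 Thm. 8.17) as a
  hypothesis, the one-sided bound on `[0, T)` gives `HasSmoothExtensionPast ν 0 u T` (restart at an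
  energy-good time `s`, `IsLerayHopfOn.exists_isLerayHopfOn_translate`; the translate is bounded on
  `[0, T - s) × ℝ³`; glue back with `HasSmoothExtensionPast.of_translate` — the pattern of
  `NSCriticalClosureBounded.lean`);
* `seregin_sverak_2002.hasSmoothExtensionPast`: the same unconditionally in the continuation step,
  by the tree's discharge `hasSmoothExtensionPast_of_bounded_holds`;
* `seregin_sverak_2002.of_head_le` / `.of_neg_le_pressure`: the two alternatives separately, the
  first being literally the statement of the route decl `OneSidedHeadRegularity`.

## References

* G. Seregin, V. Šverák, Arch. Ration. Mech. Anal. 163 (2002), 65–86, main theorem.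
  [SereginSverak2002]
* C. V. Tran, X. Yu, *Regularity of Navier–Stokes flows with bounds for the pressure*, Appl. Math.
  Lett. 67 (2017), 21–27, Thm. 1 (p. 2) — secondary restatement read. [TranYu2017]
* C. V. Tran, X. Yu, Nonlinearity 28 (2015), 1295–1306, p. 1 (normalised pressure). [TranYu2016]
* T. Tao, arXiv:1108.1165, Lemma 4.1 (i). [Tao2011]
* J. C. Robinson, J. L. Rodrigo, W. Sadowski, CUP 2016, Thm. 8.17. [RobinsonRodrigoSadowski2016]
-/

noncomputable section

open MeasureTheory Set Function Filter
open scoped ENNReal NNReal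

namespace Literature.Analysis.FluidPDE

/-- NAMED FACT (**Seregin–Šverák 2002, main theorem**: one-sided pressure / head-pressure
criterion for the Cauchy problem; transcribed from the restatement Tran–Yu 2017, Thm. 1, with
`g ≡ K`). Let `ν > 0`, `T > 0`, and let `(u, p)` be a classical solution of the unforced
Navier–Stokes system on `ℝ³ × [0, T)` which is Leray–Hopf on `[0, T)` from its rapidly decaying
datum `u 0`. If the head pressure built with the normalised pressure is bounded above,
`|u(t,x)|²/2 + p̃[u(t)](x) ≤ K` on `(0, T) × ℝ³`, or the normalised pressure is bounded below,
`p̃[u(t)](x) ≥ -K` there, then `u` is regular up to `T`: for every `δ ∈ (0, T)` it is bounded on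
`(δ, T) × ℝ³`. Users take `(h : seregin_sverak_2002)`.
[cite: SereginSverak2002, main theorem (abstract; restated as TranYu2017 Thm. 1, p. 2)] -/
def seregin_sverak_2002 : Prop :=
  ∀ (ν T : ℝ), 0 < ν → 0 < T →
    ∀ (u : ℝ → EuclideanSpace ℝ (Fin 3) → EuclideanSpace ℝ (Fin 3))
      (p : ℝ → EuclideanSpace ℝ (Fin 3) → ℝ),
      IsClassicalNSSolutionOn (Ico 0 T) ν 0 u p → IsLerayHopfOn T ν 0 (u 0) u →
        HasRapidSpatialDecay (u 0) →
          ((∃ K : ℝ, ∀ t ∈ Ioo 0 T, ∀ x, ‖u t x‖ ^ 2 / 2 + normalisedPressure (u t) x ≤ K) ∨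
            (∃ K : ℝ, ∀ t ∈ Ioo 0 T, ∀ x, -K ≤ normalisedPressure (u t) x)) →
          ∀ δ ∈ Ioo 0 T, ∃ M : ℝ, ∀ t ∈ Ioo δ T, ∀ x, ‖u t x‖ ≤ M

/-- **Continuation form, conditional on the continuation of bounded solutions.** Under
`seregin_sverak_2002` and `hasSmoothExtensionPast_of_bounded` (RRS 2016, Thm. 8.17), a classical
Leray–Hopf solution from a rapidly decaying datum with `|u|²/2 + p̃ ≤ K` or `p̃ ≥ -K` on
`(0, T) × ℝ³` extends as a classical solution past `T`. Proof: restart at an energy-good time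
`s ∈ (0, T)` (`IsLerayHopfOn.exists_isLerayHopfOn_translate`); the translate `u(· + s)` is
classical on `[0, T - s)`, Leray–Hopf from `u s`, and bounded there by the fact (bound on
`(s/2, T) × ℝ³`); continue it past `T - s` and glue (`HasSmoothExtensionPast.of_translate`).
[cite: SereginSverak2002, main theorem (abstract; restated as TranYu2017 Thm. 1, p. 2)] -/
theorem seregin_sverak_2002.hasSmoothExtensionPast_of_continuation (h : seregin_sverak_2002)
    (hB : hasSmoothExtensionPast_of_bounded) {ν T : ℝ} (hν : 0 < ν) (hT : 0 < T)
    {u : ℝ → EuclideanSpace ℝ (Fin 3) → EuclideanSpace ℝ (Fin 3)}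
    {p : ℝ → EuclideanSpace ℝ (Fin 3) → ℝ}
    (hsol : IsClassicalNSSolutionOn (Ico 0 T) ν 0 u p) (hLH : IsLerayHopfOn T ν 0 (u 0) u)
    (h₀ : HasRapidSpatialDecay (u 0))
    (hone : (∃ K : ℝ, ∀ t ∈ Ioo 0 T, ∀ x, ‖u t x‖ ^ 2 / 2 + normalisedPressure (u t) x ≤ K) ∨
      (∃ K : ℝ, ∀ t ∈ Ioo 0 T, ∀ x, -K ≤ normalisedPressure (u t) x)) :
    HasSmoothExtensionPast ν 0 u T := by
  have hbd : ∀ δ ∈ Ioo 0 T, ∃ M : ℝ, ∀ t ∈ Ioo δ T, ∀ x, ‖u t x‖ ≤ M :=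
    h ν T hν hT u p hsol hLH h₀ hone
  -- an energy-good restarting time `s ∈ (0, T)`
  obtain ⟨s, hs, hLHs⟩ := hLH.exists_isLerayHopfOn_translate hsol hν.le hT le_rfl
  -- a pointwise bound on `(s/2, T) × ℝ³`
  have hs2 : s / 2 ∈ Ioo 0 T := ⟨by linarith [hs.1], by linarith [hs.2]⟩
  obtain ⟨M, hM⟩ := hbd (s / 2) hs2
  -- the translate: classical on `[0, T - s)`, Leray–Hopf from `u s`, bounded on `[0, T - s) × ℝ³`
  have hsol' : IsClassicalNSSolutionOn (Ico 0 (T - s)) ν 0 (fun t => u (t + s))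
      (fun t => p (t + s)) := hsol.translate_Ico_zero hs.1.le
  have hLHs' : IsLerayHopfOn (T - s) ν 0 ((fun t => u (t + s)) 0) (fun t => u (t + s)) := by
    show IsLerayHopfOn (T - s) ν 0 (u (0 + s)) (fun t => u (t + s))
    rw [zero_add]
    exact hLHs
  have hMs : ∃ M : ℝ, ∀ t ∈ Ico 0 (T - s), ∀ x, ‖(fun t => u (t + s)) t x‖ ≤ M :=
    ⟨M, fun t ht x => hM (t + s) ⟨by linarith [ht.1, hs.1], by linarith [ht.2]⟩ x⟩
  -- continuation of the bounded translate past `T - s`, glued back to `u`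
  have hext : HasSmoothExtensionPast ν 0 (fun t => u (t + s)) (T - s) :=
    hB hν (sub_pos.2 hs.2) hsol' hLHs' hMs
  exact HasSmoothExtensionPast.of_translate hsol hs.1 hs.2 hext

/-- **Continuation form.** Under `seregin_sverak_2002`, a classical Leray–Hopf solution from a
rapidly decaying datum with `|u|²/2 + p̃ ≤ K` or `p̃ ≥ -K` on `(0, T) × ℝ³` extends as a classical
solution past `T`; the continuation of bounded solutions is the tree's discharged
`hasSmoothExtensionPast_of_bounded_holds` (RRS 2016, Thm. 8.17).
[cite: SereginSverak2002, main theorem (abstract; restated as TranYu2017 Thm. 1, p. 2)] -/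
theorem seregin_sverak_2002.hasSmoothExtensionPast (h : seregin_sverak_2002) {ν T : ℝ}
    (hν : 0 < ν) (hT : 0 < T)
    {u : ℝ → EuclideanSpace ℝ (Fin 3) → EuclideanSpace ℝ (Fin 3)}
    {p : ℝ → EuclideanSpace ℝ (Fin 3) → ℝ}
    (hsol : IsClassicalNSSolutionOn (Ico 0 T) ν 0 u p) (hLH : IsLerayHopfOn T ν 0 (u 0) u)
    (h₀ : HasRapidSpatialDecay (u 0))
    (hone : (∃ K : ℝ, ∀ t ∈ Ioo 0 T, ∀ x, ‖u t x‖ ^ 2 / 2 + normalisedPressure (u t) x ≤ K) ∨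
      (∃ K : ℝ, ∀ t ∈ Ioo 0 T, ∀ x, -K ≤ normalisedPressure (u t) x)) :
    HasSmoothExtensionPast ν 0 u T :=
  h.hasSmoothExtensionPast_of_continuation hasSmoothExtensionPast_of_bounded_holds hν hT hsol hLH
    h₀ hone

/-- **The head-pressure alternative** (positive part of `|u|² + 2p̃` controlled), in the exact
shape of the route decl `Summit.NavierStokesRegularity…BernoulliDeceleration.OneSidedHeadRegularity`
(bound on `[0, T) × ℝ³`, conclusion `HasSmoothExtensionPast`).
[cite: SereginSverak2002, main theorem (abstract; restated as TranYu2017 Thm. 1, p. 2)] -/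
theorem seregin_sverak_2002.of_head_le (h : seregin_sverak_2002) :
    ∀ (ν T : ℝ), 0 < ν → 0 < T →
      ∀ (u : ℝ → EuclideanSpace ℝ (Fin 3) → EuclideanSpace ℝ (Fin 3))
        (p : ℝ → EuclideanSpace ℝ (Fin 3) → ℝ),
        IsClassicalNSSolutionOn (Ico 0 T) ν 0 u p → IsLerayHopfOn T ν 0 (u 0) u →
          HasRapidSpatialDecay (u 0) →
            (∃ K : ℝ, ∀ t ∈ Ico 0 T, ∀ x, ‖u t x‖ ^ 2 / 2 + normalisedPressure (u t) x ≤ K) →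
              HasSmoothExtensionPast ν 0 u T := by
  intro ν T hν hT u p hsol hLH h₀ hK
  obtain ⟨K, hK⟩ := hK
  exact h.hasSmoothExtensionPast hν hT hsol hLH h₀
    (Or.inl ⟨K, fun t ht x => hK t (Ioo_subset_Ico_self ht) x⟩)

/-- **The pressure alternative** (negative part of `p̃` controlled: `p̃ ≥ -K` on `[0, T) × ℝ³`)
gives continuation past `T`. [cite: SereginSverak2002, main theorem (abstract; restated as TranYu2017 Thm. 1, p. 2)] -/
theorem seregin_sverak_2002.of_neg_le_pressure (h : seregin_sverak_2002) :
    ∀ (ν T : ℝ), 0 < ν → 0 < T →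
      ∀ (u : ℝ → EuclideanSpace ℝ (Fin 3) → EuclideanSpace ℝ (Fin 3))
        (p : ℝ → EuclideanSpace ℝ (Fin 3) → ℝ),
        IsClassicalNSSolutionOn (Ico 0 T) ν 0 u p → IsLerayHopfOn T ν 0 (u 0) u →
          HasRapidSpatialDecay (u 0) →
            (∃ K : ℝ, ∀ t ∈ Ico 0 T, ∀ x, -K ≤ normalisedPressure (u t) x) →
              HasSmoothExtensionPast ν 0 u T := by
  intro ν T hν hT u p hsol hLH h₀ hK
  obtain ⟨K, hK⟩ := hK
  exact h.hasSmoothExtensionPast hν hT hsol hLH h₀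
    (Or.inr ⟨K, fun t ht x => hK t (Ioo_subset_Ico_self ht) x⟩)

end Literature.Analysis.FluidPDE

end
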